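import Summits.ABC.ABC.Theses.IsogenyGlueCongruence
import Summits.ABC.ABC.Theorems.IsogenyGlueCongruenceEllipticGluingPrimeBoundStubGeomIsotypicProjector
import Summits.ABC.ABC.Theorems.IsogenyGlueCongruenceEllipticGluingPrimeBoundStubCaseB
import Literature.NumberTheory.DiophantineGeometry.AVIsogenyTate
import HarnessLib

/-!
# Crux `EllipticGluingPrimeBound`, line Sketch — stub `stub_freeOfSimple`

Stub `stub_freeOfSimple` of line `Sketch` (isotypic–Minkowski reduction, skeleton v11) of crux U
`Summit.ABC.ABC.Theses.IsogenyGlueCongruence.EllipticGluingPrimeBound` (item stmt-ABC-13919).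

**Statement.** `U_free` (irreducible form) from its `ℚ`-simple case. Suppose

* `hS` (`U_simple`, the line's residual): there are absolute `κ ≥ 0`, `C` such that for every
  elliptic curve `W/ℚ` with AV-model `E` (`e : E(ℚ̄) ≃+ W(ℚ̄)` equivariant), every **simple**
  `A/ℚ` with `Hom_ℚ̄(E, A) = 0`, and every prime `ℓ` at which `W[ℓ]` is an irreducible
  `Γ_ℚ`-module embedding `Γ_ℚ`-equivariantly into `A(ℚ̄)`, one has
  `ℓ ≤ C · ((dim A + 1) · max(1, h_F(W)))^κ`;
* `hQ` (quotient by an abelian subvariety over `ℚ`, on points — the neighbouring stub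
  `stub_quotientByAbelianSubvariety`): for a closed immersion `i : A₁ ↪ A` there are `Z'/ℚ` with
  `dim Z' + dim A₁ = dim A` and an equivariant additive `Φ : A(ℚ̄) → Z'(ℚ̄)` with kernel exactly
  `i(A₁(ℚ̄))`, along which geometric `E`-freeness transfers.

Then the same bound holds (with `κ` and `max C 0`) for **every** geometrically `E`-free `A/ℚ`.

**Proof.** Induction on `dim A` (WLOG `C ≥ 0`, the right-hand side being then monotone in
`dim A`). If `A` is simple, `hS` applies. Otherwise pick a closed immersion `i : A₁ ↪ A` with
`0 < dim A₁ < dim A`. The preimage `H = ι⁻¹(i(A₁(ℚ̄)))` of the (equivariant) subgroup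
`i(A₁(ℚ̄))` under the equivariant embedding `ι : W[ℓ] ↪ A(ℚ̄)` is `Γ_ℚ`-stable, hence `⊥` or `⊤`
by irreducibility.
* `H = ⊤`: `ι` factors through `i(ℚ̄) : A₁(ℚ̄) ↪ A(ℚ̄)` (injective: a closed immersion is a
  monomorphism), giving an equivariant embedding `W[ℓ] ↪ A₁(ℚ̄)`; `A₁` is geometrically `E`-free
  since `i_ℚ̄` is again a closed immersion, hence a monomorphism; induct (`dim A₁ < dim A`).
* `H = ⊥`: `Φ ∘ ι : W[ℓ] → Z'(ℚ̄)` is equivariant and injective (`Φ (ι P) = 0` puts `P` in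
  `H = ⊥`); `Z'` is geometrically `E`-free by transfer; induct (`dim Z' = dim A - dim A₁ < dim A`).

Tree inputs (all proved): `AbelianVariety.Hom.geomPointsMap_smul/apply`, `AlgPoints.map_apply`,
`isClosedImmersion_baseChange`, `eq_of_comp_eq_of_isClosedImmersion` (module
`…StubGeomIsotypicProjector`), `AbelianVariety.isSimple_of_dim_le_one`; Mathlib
`AddMonoidHom.ofInjective`, `Real.rpow_le_rpow`. The private lemma
`geomPointsMap_injective_of_isClosedImmersion` of `…StubCaseB` is re-proved here under a primed
name. No definitions, no cited fact — the statement is unconditional given its two hypotheses.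
-/

noncomputable section

-- `Summit.<Summit>.<Problem>` is the mandated summit-side namespace (CONVENTIONS §2); for the
-- single-conjunct summit `ABC` the two coincide, so the duplicate `ABC.ABC` is deliberate.
set_option linter.dupNamespace false

namespace Summit.ABC.ABC.Theorems.IsotypicMinkowski

open CategoryTheory CategoryTheory.Limits AlgebraicGeometry
open Literature.AlgebraicGeometry.Motives
open Summit.ABC.ABC.Theses.IsogenyGlueCongruence

/-! ### Small inputs -/

/-- A closed-immersion homomorphism is injective on geometric points (a closed immersion is a
monomorphism of schemes). Re-proof of the private lemma of the same name (unprimed) of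
`…StubCaseB`. -/
theorem geomPointsMap_injective_of_isClosedImmersion' {X Y : AbelianVariety.{0} ℚ}
    (i : X ⟶ Y) [IsClosedImmersion (AbelianVariety.Hom.toSchemeHom i)] :
    Function.Injective (AbelianVariety.Hom.geomPointsMap i) := by
  haveI : Mono i.hom.hom.hom := (Over.forget _).mono_of_mono_map (by
    change Mono (AbelianVariety.Hom.toSchemeHom i); infer_instance)
  intro x y hxy
  apply Additive.toMul.injective
  have h := congrArg Additive.toMul hxy
  rw [AbelianVariety.Hom.geomPointsMap_apply, AbelianVariety.Hom.geomPointsMap_apply,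
    AlgPoints.map_apply, AlgPoints.map_apply] at h
  exact (cancel_mono i.hom.hom.hom).1 h

/-- Geometric `E`-freeness passes to abelian subvarieties: if `i : A₁ ↪ A` is a closed immersion
and `Hom(E_ℚ̄, A_ℚ̄) = 0` then `Hom(E_ℚ̄, A₁,ℚ̄) = 0`, because `i_ℚ̄` is a closed immersion
(`isClosedImmersion_baseChange`), hence a monomorphism (`eq_of_comp_eq_of_isClosedImmersion`). -/
theorem isGeomFree_of_isClosedImmersion {E A A₁ : AbelianVariety.{0} ℚ} (i : A₁ ⟶ A)
    [IsClosedImmersion (AbelianVariety.Hom.toSchemeHom i)]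
    (hfree : ∀ f : E.baseChange (AlgebraicClosure ℚ) ⟶ A.baseChange (AlgebraicClosure ℚ), f = 0) :
    ∀ f : E.baseChange (AlgebraicClosure ℚ) ⟶ A₁.baseChange (AlgebraicClosure ℚ), f = 0 := by
  intro f
  haveI := isClosedImmersion_baseChange (AlgebraicClosure ℚ) i
  exact eq_of_comp_eq_of_isClosedImmersion
    (AbelianVariety.Hom.baseChange (AlgebraicClosure ℚ) i) ((hfree _).trans zero_comp.symm)

/-- Factoring an equivariant embedding through an equivariant injection: if `j : M₁ ↪ M` and
`ι : T ↪ M` are injective and `G`-equivariant and `ι(T) ⊆ j(M₁)`, then `ι = j ∘ ι₁` for an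
injective `G`-equivariant `ι₁ : T → M₁` (`ι₁ = j⁻¹ ∘ ι` via `AddMonoidHom.ofInjective`). -/
theorem exists_lift_of_forall_mem_range {G T M₁ M : Type*} [AddCommGroup T] [AddCommGroup M₁]
    [AddCommGroup M] [SMul G T] [SMul G M₁] [SMul G M] (j : M₁ →+ M)
    (hj : Function.Injective j) (hjσ : ∀ (σ : G) (a : M₁), j (σ • a) = σ • j a) (ι : T →+ M)
    (hι : Function.Injective ι) (hισ : ∀ (σ : G) (P : T), ι (σ • P) = σ • ι P)
    (hrange : ∀ P : T, ι P ∈ j.range) :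
    ∃ ι₁ : T →+ M₁, Function.Injective ι₁ ∧ ∀ (σ : G) (P : T), ι₁ (σ • P) = σ • ι₁ P := by
  let ι₁ : T →+ M₁ :=
    (AddMonoidHom.ofInjective hj).symm.toAddMonoidHom.comp (ι.codRestrict j.range hrange)
  have hι₁ : ∀ P, j (ι₁ P) = ι P := fun P ↦
    AddMonoidHom.apply_ofInjective_symm hj ⟨ι P, hrange P⟩
  refine ⟨ι₁, fun P Q h ↦ hι (by rw [← hι₁ P, ← hι₁ Q, h]), fun σ P ↦ hj ?_⟩
  rw [hι₁, hjσ, hι₁, hισ]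

/-- Monotonicity of the bound in the dimension: for `C ≥ 0`, `κ ≥ 0`, `m ≥ 0` and `d ≤ d'`,
`x ≤ C ((d + 1) m)^κ` implies `x ≤ C ((d' + 1) m)^κ`. -/
theorem le_bound_of_dim_le {C κ m x : ℝ} (hC : 0 ≤ C) (hκ : 0 ≤ κ) (hm : 0 ≤ m) {d d' : ℕ}
    (hd : d ≤ d') (hx : x ≤ C * (((d : ℝ) + 1) * m) ^ κ) :
    x ≤ C * (((d' : ℝ) + 1) * m) ^ κ := by
  have hd' : (d : ℝ) + 1 ≤ (d' : ℝ) + 1 := by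
    have : (d : ℝ) ≤ d' := by exact_mod_cast hd
    linarith
  have h0 : (0 : ℝ) ≤ ((d : ℝ) + 1) * m := mul_nonneg (by positivity) hm
  exact hx.trans (mul_le_mul_of_nonneg_left
    (Real.rpow_le_rpow h0 (mul_le_mul_of_nonneg_right hd' hm) hκ) hC)

/-! ### The induction on `dim A` -/

/-- **The induction.** With `C ≥ 0`, the simple case `hS` and the quotient construction `hQ`, the
bound `ℓ ≤ C ((dim A + 1) max(1, h_F(W)))^κ` holds for every geometrically `E`-free `A/ℚ` of
dimension `≤ n` carrying an equivariant embedding `ι : W[ℓ] ↪ A(ℚ̄)` at a prime `ℓ` with `W[ℓ]`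
irreducible — by induction on `n`: a non-simple `A` has a closed immersion `i : A₁ ↪ A` with
`0 < dim A₁ < dim A`; the `Γ_ℚ`-stable `H = ι⁻¹(i A₁(ℚ̄)) ≤ W[ℓ]` is `⊤` (then `W[ℓ] ↪ A₁(ℚ̄)`,
`A₁` geometrically `E`-free) or `⊥` (then `W[ℓ] ↪ Z'(ℚ̄)` through `Φ` of `hQ`, `Z'` geometrically
`E`-free), and both have dimension `< dim A`. -/
theorem free_bound_of_dim_le {κ C : ℝ} (hκ : 0 ≤ κ) (hC : 0 ≤ C)
    (hS : ∀ (W : WeierstrassCurve ℚ) [W.IsElliptic] (E A : AbelianVariety.{0} ℚ)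
      (e : E.geomPoints ≃+ W.geomPoints),
      (∀ (σ : Field.absoluteGaloisGroup ℚ) (P : E.geomPoints), e (σ • P) = σ • e P) →
      (∀ f : E.baseChange (AlgebraicClosure ℚ) ⟶ A.baseChange (AlgebraicClosure ℚ), f = 0) →
      AbelianVariety.IsSimple A →
      ∀ ℓ : ℕ, ℓ.Prime → W.HasIrreducibleModPGaloisRep ℓ →
      (∃ ι : W.geomTorsion ℓ →+ A.geomPoints, Function.Injective ι ∧
        ∀ (σ : Field.absoluteGaloisGroup ℚ) (P : W.geomTorsion ℓ), ι (σ • P) = σ • ι P) →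
        (ℓ : ℝ) ≤ C * (((A.dim : ℝ) + 1) * max 1 W.stableFaltingsHeight) ^ κ)
    (hQ : ∀ (A A₁ : AbelianVariety.{0} ℚ) (i : A₁ ⟶ A),
      IsClosedImmersion (AbelianVariety.Hom.toSchemeHom i) →
      ∃ (Z' : AbelianVariety.{0} ℚ) (Φ : A.geomPoints →+ Z'.geomPoints),
        Z'.dim + A₁.dim = A.dim ∧
        (∀ (σ : Field.absoluteGaloisGroup ℚ) (P : A.geomPoints), Φ (σ • P) = σ • Φ P) ∧
        (∀ P : A.geomPoints, Φ P = 0 ↔ P ∈ (AbelianVariety.Hom.geomPointsMap i).range) ∧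
        ∀ X : AbelianVariety.{0} (AlgebraicClosure ℚ),
          (∀ f : X ⟶ A.baseChange (AlgebraicClosure ℚ), f = 0) →
          ∀ f : X ⟶ Z'.baseChange (AlgebraicClosure ℚ), f = 0)
    (n : ℕ) (W : WeierstrassCurve ℚ) [W.IsElliptic] (E : AbelianVariety.{0} ℚ)
    (e : E.geomPoints ≃+ W.geomPoints)
    (he : ∀ (σ : Field.absoluteGaloisGroup ℚ) (P : E.geomPoints), e (σ • P) = σ • e P)
    {ℓ : ℕ} (hℓ : ℓ.Prime) (hirr : W.HasIrreducibleModPGaloisRep ℓ) (A : AbelianVariety.{0} ℚ)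
    (hfree : ∀ f : E.baseChange (AlgebraicClosure ℚ) ⟶ A.baseChange (AlgebraicClosure ℚ), f = 0)
    (ι : W.geomTorsion ℓ →+ A.geomPoints) (hι : Function.Injective ι)
    (hιe : ∀ (σ : Field.absoluteGaloisGroup ℚ) (P : W.geomTorsion ℓ), ι (σ • P) = σ • ι P)
    (hdim : A.dim ≤ n) :
    (ℓ : ℝ) ≤ C * (((A.dim : ℝ) + 1) * max 1 W.stableFaltingsHeight) ^ κ := by
  induction n generalizing A with
  | zero =>
    exact hS W E A e he hfree (AbelianVariety.isSimple_of_dim_le_one (by omega)) ℓ hℓ hirr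
      ⟨ι, hι, hιe⟩
  | succ n ih =>
    by_cases hsim : AbelianVariety.IsSimple A
    · exact hS W E A e he hfree hsim ℓ hℓ hirr ⟨ι, hι, hιe⟩
    -- a non-zero proper abelian subvariety `i : A₁ ↪ A`
    obtain ⟨A₁, i, hi, hpos, hlt⟩ : ∃ (A₁ : AbelianVariety.{0} ℚ) (i : A₁ ⟶ A),
        IsClosedImmersion (AbelianVariety.Hom.toSchemeHom i) ∧ 0 < A₁.dim ∧ A₁.dim < A.dim := by
      by_contra hne
      exact hsim fun B f h1 h2 h3 ↦ hne ⟨B, f, h1, h2, h3⟩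
    haveI := hi
    have hinj : Function.Injective (AbelianVariety.Hom.geomPointsMap i) :=
      geomPointsMap_injective_of_isClosedImmersion' i
    have hm0 : (0 : ℝ) ≤ max 1 W.stableFaltingsHeight := zero_le_one.trans (le_max_left _ _)
    -- `H = ι⁻¹ (i A₁(ℚ̄))`, a `Γ_ℚ`-stable subgroup of `W[ℓ]`, is `⊥` or `⊤`
    obtain ⟨H, hH⟩ : ∃ H : AddSubgroup (W.geomTorsion ℓ),
        H = (AbelianVariety.Hom.geomPointsMap i).range.comap ι := ⟨_, rfl⟩
    have hmemH : ∀ P : W.geomTorsion ℓ,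
        P ∈ H ↔ ι P ∈ (AbelianVariety.Hom.geomPointsMap i).range := by
      intro P
      rw [hH, AddSubgroup.mem_comap]
    have hstab : ∀ (σ : Field.absoluteGaloisGroup ℚ), ∀ P ∈ H, σ • P ∈ H := by
      intro σ P hP
      rw [hmemH] at hP ⊢
      obtain ⟨a, ha⟩ := AddMonoidHom.mem_range.1 hP
      refine AddMonoidHom.mem_range.2 ⟨σ • a, ?_⟩
      rw [AbelianVariety.Hom.geomPointsMap_smul, ha, hιe]
    rcases hirr H hstab with hbot | htop
    · -- `W[ℓ]` meets `A₁` trivially: embed `W[ℓ]` into the quotient `Z'` through `Φ`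
      obtain ⟨Z', Φ, hdimZ, hΦσ, hΦker, hΦfree⟩ := hQ A A₁ i hi
      have hι' : Function.Injective (Φ.comp ι) := by
        rw [injective_iff_map_eq_zero]
        intro P hP
        have hPH : P ∈ H := (hmemH P).2 ((hΦker (ι P)).1 hP)
        rw [hbot] at hPH
        exact AddSubgroup.mem_bot.1 hPH
      have hι'e : ∀ (σ : Field.absoluteGaloisGroup ℚ) (P : W.geomTorsion ℓ),
          Φ.comp ι (σ • P) = σ • Φ.comp ι P := by
        intro σ P
        rw [AddMonoidHom.comp_apply, AddMonoidHom.comp_apply, hιe, hΦσ]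
      have hZ := ih Z' (hΦfree _ hfree) (Φ.comp ι) hι' hι'e (by omega)
      exact le_bound_of_dim_le hC hκ hm0 (by omega) hZ
    · -- `W[ℓ]` lands in `A₁`: restrict `ι` to `A₁`
      have hrange : ∀ P : W.geomTorsion ℓ, ι P ∈ (AbelianVariety.Hom.geomPointsMap i).range := by
        intro P
        rw [← hmemH, htop]
        exact AddSubgroup.mem_top P
      obtain ⟨ι₁, hι₁, hι₁e⟩ := exists_lift_of_forall_mem_range (AbelianVariety.Hom.geomPointsMap i)
        hinj (fun σ a ↦ AbelianVariety.Hom.geomPointsMap_smul i σ a) ι hι hιe hrange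
      have h₁ := ih A₁ (isGeomFree_of_isClosedImmersion (E := E) i hfree) ι₁ hι₁ hι₁e (by omega)
      exact le_bound_of_dim_le hC hκ hm0 hlt.le h₁

/-! ### The stub -/

/-- **Stub `stub_freeOfSimple` (NEW in skeleton v11) of line Sketch: `U_free` from its `ℚ`-simple
case.** If the height-free torsion-sharing bound holds for **ℚ-simple** geometrically `E`-free
partners at primes where `W[ℓ]` is irreducible (`hS` = `U_simple`), and abelian subvarieties over
`ℚ` have quotients on points (`hQ` = `stub_quotientByAbelianSubvariety`), then the bound holds for
ALL geometrically `E`-free partners, with the same exponent `κ` and the constant `max C 0`: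
induction on `dim A` (`free_bound_of_dim_le`) — if `A` is not simple, pick `i : A₁ ↪ A` with
`0 < dim A₁ < dim A`; the preimage of `i(A₁(ℚ̄))` under `ι : W[ℓ] ↪ A(ℚ̄)` is `Γ_ℚ`-stable, hence
`⊤` (then `W[ℓ] ↪ A₁(ℚ̄)`, closed immersions being injective on points, and `A₁` is geometrically
`E`-free through `i_ℚ̄`) or `⊥` (then `W[ℓ] ↪ Z'(ℚ̄)` through `Φ`); both have smaller dimension,
and the bound is monotone in `dim A` once `C ≥ 0`. -/
theorem stub_freeOfSimple
    (hS : ∃ κ C : ℝ, 0 ≤ κ ∧ ∀ (W : WeierstrassCurve ℚ) [W.IsElliptic] (E A : AbelianVariety.{0} ℚ)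
      (e : E.geomPoints ≃+ W.geomPoints),
      (∀ (σ : Field.absoluteGaloisGroup ℚ) (P : E.geomPoints), e (σ • P) = σ • e P) →
      (∀ f : E.baseChange (AlgebraicClosure ℚ) ⟶ A.baseChange (AlgebraicClosure ℚ), f = 0) →
      AbelianVariety.IsSimple A →
      ∀ ℓ : ℕ, ℓ.Prime → W.HasIrreducibleModPGaloisRep ℓ →
      (∃ ι : W.geomTorsion ℓ →+ A.geomPoints, Function.Injective ι ∧
        ∀ (σ : Field.absoluteGaloisGroup ℚ) (P : W.geomTorsion ℓ), ι (σ • P) = σ • ι P) →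
        (ℓ : ℝ) ≤ C * (((A.dim : ℝ) + 1) * max 1 W.stableFaltingsHeight) ^ κ)
    (hQ : ∀ (A A₁ : AbelianVariety.{0} ℚ) (i : A₁ ⟶ A),
      IsClosedImmersion (AbelianVariety.Hom.toSchemeHom i) →
      ∃ (Z' : AbelianVariety.{0} ℚ) (Φ : A.geomPoints →+ Z'.geomPoints),
        Z'.dim + A₁.dim = A.dim ∧
        (∀ (σ : Field.absoluteGaloisGroup ℚ) (P : A.geomPoints), Φ (σ • P) = σ • Φ P) ∧
        (∀ P : A.geomPoints, Φ P = 0 ↔ P ∈ (AbelianVariety.Hom.geomPointsMap i).range) ∧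
        ∀ X : AbelianVariety.{0} (AlgebraicClosure ℚ),
          (∀ f : X ⟶ A.baseChange (AlgebraicClosure ℚ), f = 0) →
          ∀ f : X ⟶ Z'.baseChange (AlgebraicClosure ℚ), f = 0) :
    ∃ κ C : ℝ, 0 ≤ κ ∧ ∀ (W : WeierstrassCurve ℚ) [W.IsElliptic] (E A : AbelianVariety.{0} ℚ)
      (e : E.geomPoints ≃+ W.geomPoints),
      (∀ (σ : Field.absoluteGaloisGroup ℚ) (P : E.geomPoints), e (σ • P) = σ • e P) →
      (∀ f : E.baseChange (AlgebraicClosure ℚ) ⟶ A.baseChange (AlgebraicClosure ℚ), f = 0) →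
      ∀ ℓ : ℕ, ℓ.Prime → W.HasIrreducibleModPGaloisRep ℓ →
      (∃ ι : W.geomTorsion ℓ →+ A.geomPoints, Function.Injective ι ∧
        ∀ (σ : Field.absoluteGaloisGroup ℚ) (P : W.geomTorsion ℓ), ι (σ • P) = σ • ι P) →
        (ℓ : ℝ) ≤ C * (((A.dim : ℝ) + 1) * max 1 W.stableFaltingsHeight) ^ κ := by
  obtain ⟨κ, C, hκ, hS⟩ := hS
  refine ⟨κ, max C 0, hκ, ?_⟩
  intro W _ E A e he hfree ℓ hℓ hirr hemb
  obtain ⟨ι, hι, hιe⟩ := hemb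
  refine free_bound_of_dim_le hκ (le_max_right C 0) ?_ hQ A.dim W E e he hℓ hirr A hfree ι hι hιe
    le_rfl
  -- the simple case with the constant `max C 0 ≥ C`
  intro W _ E A e he hfree hsim ℓ hℓ hirr hemb
  have hm0 : (0 : ℝ) ≤ max 1 W.stableFaltingsHeight := zero_le_one.trans (le_max_left _ _)
  exact (hS W E A e he hfree hsim ℓ hℓ hirr hemb).trans
    (mul_le_mul_of_nonneg_right (le_max_left _ _)
      (Real.rpow_nonneg (mul_nonneg (by positivity) hm0) κ))

end Summit.ABC.ABC.Theorems.IsotypicMinkowski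

end
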